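import Summits.ResolutionOfSingularities.ResolutionOfSingularities.Theorems.EquisingularLiftEquisingularLiftNatSpecimenS10ConicUnobsAlgebra
import Summits.ResolutionOfSingularities.ResolutionOfSingularities.Theorems.EquisingularLiftEquisingularLiftNatDirStepUnobsOfCharts
import Literature.AlgebraicGeometry.Resolution.ProjectiveSpaceRegular
import HarnessLib

/-!
# [OURS · L1 W4.5(b) · EL♮(3) · WIDTH TABLE D3, brick D3-8 (2/2)] The ℙ² CONIC MODEL CERTIFICATE of `DirStepUnobs`:
# `DirStepUnobs ℙ²_k univ _ V₊(X₀X₁ + X₂²) _` — the first customer of the unobstructedness producer `dirStepUnobs_univ_of_two_charts`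

Cell `res-hironaka`, LADDER-RESOLUTION rung L (D-0089), slot W4.5(b), crux chain w45b: child crux **EL♮(3)** = stmt-ResolutionOfSingularities-20148
(`Theses.EquisingularLift.EquisingularLiftNatThree`), parent EL♮ = stmt-…-20038; iso residue of record `stub_elnat_three_isolated_nonNDLeaves` (38th
registration, CHILD v44r) and its A⁵ = NEST(1) programme (desk R39, WIDTH TABLE D3). WIDTH seat res-L1-w45b-iso-w4 g2 (D-0157 DOOR 1), desk booking D3-8
(STATUS 2026-08-28T17:53:01Z). `--supports stmt-ResolutionOfSingularities-20148 --as helper`. OURS; NOT a statement of H. Hironaka's 2017 manuscript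
(nothing of [Hironaka2017] is asserted); AI-written, and AI review is weaker than expert review. DEF-FREE; no `sorry`; standard axioms. EL♮(3) is NOT proved
by this file; resolution of singularities in positive characteristic is NOT proved here (dimension 3 is Cossart–Piltant 2008/2009 in print) — this is OUR
kernel-own certificate for one side clause of the chain's NEST step, counted 0 toward the summit.

WHY. The NEST generating step `TowerNestB₅` (res-L1-w45b-stub-4, D3-1) blows up an irreducible regular curve `Z` inside the FRESH exceptional plane
`E' ≅ ℙ²` born at the preceding point step, under the side clause `DirStepUnobs G' E' _ Z _` («`H¹(Z̃, 𝒩_{Z̃/Ẽ'}) = 0` in Čech form», `…NatDirZeroDefs`).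
Desk R39 (i): «`DirStepUnobs` stays a residue-side clause certified per specimen»; its first named customer is res-L1-w45b-lead-1's S10 germ, whose NEST
centre is the smooth CONIC `Γ_q = {x₁² + y₁z₁ = 0} ⊂ E_q` (normal bundle `𝒪_{ℙ¹}(4)`). The customer door is res-L1-w45b-iso-w2's D3-10
`dirStepUnobs_of_model_iso`: a MODEL certificate on `P = ℙ²` plus one isomorphism «fresh plane ≅ ℙ²» carrying `Γ_q` onto the model curve. THIS FILE IS THE
MODEL CERTIFICATE, over every field `k`, obtained from res-L1-w45b-nose-w1's producer `dirStepUnobs_univ_of_two_charts` (✓ p655133) fed with: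
charts `D₊(X₀)`, `D₊(X₁)` (the tree's `SmoothHypersurface.coordChartOpen k 0 / 1`); generators `toChart(y₀ + y₁²) = F/X₀², F/X₁²`
(quasi-regular = non-zero-divisors; they GENERATE the ideal of the reduced conic by the tree's `idealSheaf_ideal_coordChartOpen` + primality);
transition `M = ((X₁/X₀)²)|`; the twisted splitting of `…NatSpecimenS10ConicUnobsAlgebra` transported along
`(k[X]_{(X₀X₁)})₀ ≅ Γ(D₊(X₀X₁)) = Γ(D₊(X₀) ∩ D₊(X₁))` (Mathlib `Proj.awayToSection`, `Proj.awayMap_awayToSection`, `Proj.basicOpen_mul`).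

WHAT. `res₀_awayToSection` / `res₁_awayToSection`, `surjective_res_awayToSection₀₁`, `span_toChart_conic_eq_ideal`, `isQuasiRegular_toChart_conic`,
`res₀_toChart_conic_mem`, `conic_transition_sections`, `conic_twisted_splitting_sections`, and
★★ `S10Conic.dirStepUnobs_conic : DirStepUnobs (Proj k[X₀,X₁,X₂]) univ _ (V₊(X₀X₁ + X₂²)) _` (`Proj k[X₀,X₁,X₂] = (projectiveSpace 2 k).left` by `rfl`).
DICTIONARY for the S10 customer: `(X₀, X₁, X₂) = (y₁, z₁, x₁)`, `Γ_q = V₊(X₀X₁ + X₂²)`, `Eq.y = D₊(X₀)`, `Eq.z = D₊(X₁)` (res-L1-w45b-lead-1 l.82605).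

References (method / index only): R. Hartshorne, *Algebraic Geometry* (1977), II Prop. 2.5 (b), II Example 3.2.6, III.5 [cite: Hartshorne1977];
The Stacks Project, Tag 01ED [cite: StacksProject].
-/

set_option linter.dupNamespace false

noncomputable section

-- `TopCat.Presheaf`/`Scheme.Modules` are not reducible (as in Mathlib's `AlgebraicGeometry/Modules`).
set_option backward.isDefEq.respectTransparency false

open CategoryTheory AlgebraicGeometry Opposite TopologicalSpace MvPolynomial HomogeneousLocalization

namespace Summit.ResolutionOfSingularities.ResolutionOfSingularities.Cruxes.EquisingularLiftNat.Sections

namespace S10Conic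

/-! ### Part C. The model certificate: `DirStepUnobs ℙ²_k univ (V₊(X₀X₁ + X₂²))` -/

section Certificate

open Literature.AlgebraicGeometry.Motives Literature.AlgebraicGeometry.Motives.ProjectiveSpace

variable (k : Type) [Field k]

attribute [local instance] MvPolynomial.gradedAlgebra ProjBaseChange.algebraBase

/-- `D₊(X₀) ∩ D₊(X₁) ≤ D₊(X₀X₁)` (equality, Mathlib `Proj.basicOpen_mul`), in the spelling of the charts `coordChartOpen`. -/
theorem inf_coordChartOpen_le :
    ((SmoothHypersurface.coordChartOpen (n := 1) k 0 : (Proj (MvPolynomial.homogeneousSubmodule (Fin 3) k)).Opens) ⊓ (SmoothHypersurface.coordChartOpen (n := 1) k 1 : (Proj (MvPolynomial.homogeneousSubmodule (Fin 3) k)).Opens)) ≤ Proj.basicOpen (MvPolynomial.homogeneousSubmodule (Fin 3) k) (X 0 * X 1) :=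
  (Proj.basicOpen_mul (MvPolynomial.homogeneousSubmodule (Fin 3) k) (X 0) (X 1)).ge

/-- The converse inequality. -/
theorem basicOpen_mul_le_inf_coordChartOpen :
    Proj.basicOpen (MvPolynomial.homogeneousSubmodule (Fin 3) k) (X 0 * X 1) ≤ ((SmoothHypersurface.coordChartOpen (n := 1) k 0 : (Proj (MvPolynomial.homogeneousSubmodule (Fin 3) k)).Opens) ⊓ (SmoothHypersurface.coordChartOpen (n := 1) k 1 : (Proj (MvPolynomial.homogeneousSubmodule (Fin 3) k)).Opens)) :=
  (Proj.basicOpen_mul (MvPolynomial.homogeneousSubmodule (Fin 3) k) (X 0) (X 1)).le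

/-- Restriction `Γ(D₊(X₀)) → Γ(D₊(X₀) ∩ D₊(X₁))` of a section `a/X₀ⁿ` is `awayMap` (`a X₁ⁿ/(X₀X₁)ⁿ`) read through `Γ(D₊(X₀X₁)) → Γ(D₊(X₀) ∩ D₊(X₁))`
(Mathlib `Proj.awayMap_awayToSection`). -/
theorem res₀_awayToSection (z : HomogeneousLocalization.Away (MvPolynomial.homogeneousSubmodule (Fin 3) k) (X 0 : MvPolynomial (Fin 3) k)) :
    (Proj (MvPolynomial.homogeneousSubmodule (Fin 3) k)).presheaf.map (homOfLE (inf_le_left : ((SmoothHypersurface.coordChartOpen (n := 1) k 0 : (Proj (MvPolynomial.homogeneousSubmodule (Fin 3) k)).Opens) ⊓ (SmoothHypersurface.coordChartOpen (n := 1) k 1 : (Proj (MvPolynomial.homogeneousSubmodule (Fin 3) k)).Opens)) ≤ (SmoothHypersurface.coordChartOpen (n := 1) k 0 : (Proj (MvPolynomial.homogeneousSubmodule (Fin 3) k)).Opens))).op ((Proj.awayToSection (MvPolynomial.homogeneousSubmodule (Fin 3) k) (X 0)).hom z) =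
      (Proj (MvPolynomial.homogeneousSubmodule (Fin 3) k)).presheaf.map (homOfLE (inf_coordChartOpen_le k)).op
        ((Proj.awayToSection (MvPolynomial.homogeneousSubmodule (Fin 3) k) (X 0 * X 1)).hom
          (awayMap (MvPolynomial.homogeneousSubmodule (Fin 3) k) (X_mem 1) (rfl : (X 0 * X 1 : MvPolynomial (Fin 3) k) = X 0 * X 1) z)) := by
  have h := Proj.awayMap_awayToSection (MvPolynomial.homogeneousSubmodule (Fin 3) k) (X_mem (R := k) (n := 2) 1) (rfl : (X 0 * X 1 : MvPolynomial (Fin 3) k) = X 0 * X 1)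
  have h' := congrArg (fun φ => (φ ≫ (Proj (MvPolynomial.homogeneousSubmodule (Fin 3) k)).presheaf.map (homOfLE (inf_coordChartOpen_le k)).op).hom z) h
  simp only [Category.assoc, ← Functor.map_comp, ← op_comp] at h'
  exact h'.symm

/-- The same for the chart `D₊(X₁)`. -/
theorem res₁_awayToSection (z : HomogeneousLocalization.Away (MvPolynomial.homogeneousSubmodule (Fin 3) k) (X 1 : MvPolynomial (Fin 3) k)) :
    (Proj (MvPolynomial.homogeneousSubmodule (Fin 3) k)).presheaf.map (homOfLE (inf_le_right : ((SmoothHypersurface.coordChartOpen (n := 1) k 0 : (Proj (MvPolynomial.homogeneousSubmodule (Fin 3) k)).Opens) ⊓ (SmoothHypersurface.coordChartOpen (n := 1) k 1 : (Proj (MvPolynomial.homogeneousSubmodule (Fin 3) k)).Opens)) ≤ (SmoothHypersurface.coordChartOpen (n := 1) k 1 : (Proj (MvPolynomial.homogeneousSubmodule (Fin 3) k)).Opens))).op ((Proj.awayToSection (MvPolynomial.homogeneousSubmodule (Fin 3) k) (X 1)).hom z) =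
      (Proj (MvPolynomial.homogeneousSubmodule (Fin 3) k)).presheaf.map (homOfLE (inf_coordChartOpen_le k)).op
        ((Proj.awayToSection (MvPolynomial.homogeneousSubmodule (Fin 3) k) (X 0 * X 1)).hom
          (awayMap (MvPolynomial.homogeneousSubmodule (Fin 3) k) (X_mem 0) (mul_comm (X 0 : MvPolynomial (Fin 3) k) (X 1)) z)) := by
  have h := Proj.awayMap_awayToSection (MvPolynomial.homogeneousSubmodule (Fin 3) k) (X_mem (R := k) (n := 2) 0) (mul_comm (X 0 : MvPolynomial (Fin 3) k) (X 1))
  have h' := congrArg (fun φ => (φ ≫ (Proj (MvPolynomial.homogeneousSubmodule (Fin 3) k)).presheaf.map (homOfLE (inf_coordChartOpen_le k)).op).hom z) h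
  simp only [Category.assoc, ← Functor.map_comp, ← op_comp] at h'
  exact h'.symm

/-- `(k[X]_{(X₀X₁)})₀ → Γ(D₊(X₀X₁)) → Γ(D₊(X₀) ∩ D₊(X₁))` is onto (an isomorphism followed by restriction along an equality of opens). -/
theorem surjective_res_awayToSection₀₁ :
    Function.Surjective (((Proj (MvPolynomial.homogeneousSubmodule (Fin 3) k)).presheaf.map (homOfLE (inf_coordChartOpen_le k)).op).hom.comp
      (Proj.awayToSection (MvPolynomial.homogeneousSubmodule (Fin 3) k) (X 0 * X 1)).hom) := by
  intro s
  obtain ⟨z, hz⟩ := (Proj.basicOpenIsoAway (MvPolynomial.homogeneousSubmodule (Fin 3) k) (X 0 * X 1) (X01_mem k) two_pos).commRingCatIsoToRingEquiv.surjective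
    ((Proj (MvPolynomial.homogeneousSubmodule (Fin 3) k)).presheaf.map (homOfLE (basicOpen_mul_le_inf_coordChartOpen k)).op s)
  refine ⟨z, ?_⟩
  have hz' : (Proj.awayToSection (MvPolynomial.homogeneousSubmodule (Fin 3) k) (X 0 * X 1)).hom z = (Proj (MvPolynomial.homogeneousSubmodule (Fin 3) k)).presheaf.map (homOfLE (basicOpen_mul_le_inf_coordChartOpen k)).op s := by
    rw [← hz]; rfl
  rw [RingHom.comp_apply, hz', ← CommRingCat.comp_apply, ← Functor.map_comp, ← op_comp]
  have hid : (homOfLE (inf_coordChartOpen_le k) ≫ homOfLE (basicOpen_mul_le_inf_coordChartOpen k) : ((SmoothHypersurface.coordChartOpen (n := 1) k 0 : (Proj (MvPolynomial.homogeneousSubmodule (Fin 3) k)).Opens) ⊓ (SmoothHypersurface.coordChartOpen (n := 1) k 1 : (Proj (MvPolynomial.homogeneousSubmodule (Fin 3) k)).Opens)) ⟶ _) = 𝟙 _ :=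
    Subsingleton.elim _ _
  rw [hid, op_id, CategoryTheory.Functor.map_id]
  rfl

/-- On the chart `D₊(Xᵢ)` (`i = 0, 1`) the section `toChart(y₀ + y₁²)` GENERATES the ideal of the reduced conic `V₊(X₀X₁ + X₂²)` (the tree's
`idealSheaf_ideal_coordChartOpen` = Nullstellensatz on the chart, plus primality of `(y₀ + y₁²)`). -/
theorem span_toChart_conic_eq_ideal (i : Fin 3) (hi : i = 0 ∨ i = 1) :
    Ideal.span {(Proj.awayToSection (MvPolynomial.homogeneousSubmodule (Fin 3) k) (X i)).hom (toChart k i (X 0 + X 1 ^ 2))} =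
      (SmoothHypersurface.idealSheaf (X 0 * X 1 + X 2 ^ 2 : MvPolynomial (Fin 3) k)).ideal (SmoothHypersurface.coordChartOpen k i) := by
  rw [SmoothHypersurface.idealSheaf_ideal_coordChartOpen _ i (isHomogeneous_conic k) two_pos, SmoothHypersurface.chartIdeal,
    chartEqn_conic_eq k i hi, (isPrime_span_toChart_conic k i).radical, Ideal.map_span, Set.image_singleton]

/-- The one-element family `toChart(y₀ + y₁²)` on `D₊(Xᵢ)` is quasi-regular (a non-zero-divisor: the chart ring is the domain `k[y₀, y₁]`). -/
theorem isQuasiRegular_toChart_conic (i : Fin 3) :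
    Literature.AlgebraicGeometry.Resolution.IsQuasiRegular
      (fun _ : Fin 1 => (Proj.awayToSection (MvPolynomial.homogeneousSubmodule (Fin 3) k) (X i)).hom (toChart k i (X 0 + X 1 ^ 2))) := by
  refine Literature.AlgebraicGeometry.Resolution.isQuasiRegular_of_regularSeq 1 _ fun j y hy => ?_
  have hIio : (fun _ : Fin 1 => (Proj.awayToSection (MvPolynomial.homogeneousSubmodule (Fin 3) k) (X i)).hom (toChart k i (X 0 + X 1 ^ 2))) '' Set.Iio j = ∅ := by
    rw [Set.image_eq_empty]; ext j'; simp [Subsingleton.elim j' j]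
  rw [hIio, Ideal.span_empty, Ideal.mem_bot] at hy ⊢
  obtain ⟨y', rfl⟩ := (SmoothHypersurface.awayEquivSections (k := k) i).surjective y
  rw [← SmoothHypersurface.awayEquivSections_apply, ← map_mul,
    map_eq_zero_iff _ (SmoothHypersurface.awayEquivSections i).injective] at hy
  rw [eq_zero_of_toChart_conic_mul_eq_zero k i y' hy, map_zero]

/-- The restricted generator `(F/X₀²)|` lies in the ideal of the conic over `D₊(X₀) ∩ D₊(X₁)` (ideal sheaf data are compatible with restriction). -/
theorem res₀_toChart_conic_mem (h01 : IsAffineOpen ((SmoothHypersurface.coordChartOpen (n := 1) k 0 : (Proj (MvPolynomial.homogeneousSubmodule (Fin 3) k)).Opens) ⊓ (SmoothHypersurface.coordChartOpen (n := 1) k 1 : (Proj (MvPolynomial.homogeneousSubmodule (Fin 3) k)).Opens))) :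
    (Proj (MvPolynomial.homogeneousSubmodule (Fin 3) k)).presheaf.map (homOfLE (inf_le_left : ((SmoothHypersurface.coordChartOpen (n := 1) k 0 : (Proj (MvPolynomial.homogeneousSubmodule (Fin 3) k)).Opens) ⊓ (SmoothHypersurface.coordChartOpen (n := 1) k 1 : (Proj (MvPolynomial.homogeneousSubmodule (Fin 3) k)).Opens)) ≤ (SmoothHypersurface.coordChartOpen (n := 1) k 0 : (Proj (MvPolynomial.homogeneousSubmodule (Fin 3) k)).Opens))).op
        ((Proj.awayToSection (MvPolynomial.homogeneousSubmodule (Fin 3) k) (X 0)).hom (toChart k 0 (X 0 + X 1 ^ 2))) ∈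
      (SmoothHypersurface.idealSheaf (X 0 * X 1 + X 2 ^ 2 : MvPolynomial (Fin 3) k)).ideal ⟨_, h01⟩ := by
  have hx₀mem : (Proj.awayToSection (MvPolynomial.homogeneousSubmodule (Fin 3) k) (X 0)).hom (toChart k 0 (X 0 + X 1 ^ 2)) ∈
      (SmoothHypersurface.idealSheaf (X 0 * X 1 + X 2 ^ 2 : MvPolynomial (Fin 3) k)).ideal (SmoothHypersurface.coordChartOpen k 0) := by
    rw [← span_toChart_conic_eq_ideal k 0 (Or.inl rfl)]
    exact Ideal.subset_span rfl
  have h := Scheme.IdealSheafData.ideal_le_comap_ideal (SmoothHypersurface.idealSheaf (X 0 * X 1 + X 2 ^ 2 : MvPolynomial (Fin 3) k))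
    (U := ⟨_, h01⟩) (V := SmoothHypersurface.coordChartOpen (n := 1) k 0)
    (show ((SmoothHypersurface.coordChartOpen (n := 1) k 0 : (Proj (MvPolynomial.homogeneousSubmodule (Fin 3) k)).Opens) ⊓ (SmoothHypersurface.coordChartOpen (n := 1) k 1 : (Proj (MvPolynomial.homogeneousSubmodule (Fin 3) k)).Opens)) ≤ (SmoothHypersurface.coordChartOpen (n := 1) k 0 : (Proj (MvPolynomial.homogeneousSubmodule (Fin 3) k)).Opens) from inf_le_left) hx₀mem
  exact Ideal.mem_comap.1 h

/-- **The transition on sections**: `(F/X₀²)| = M · (F/X₁²)|` on `D₊(X₀) ∩ D₊(X₁)`, `M = ((X₁/X₀)²)|` read through `Γ(D₊(X₀X₁))`. -/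
theorem conic_transition_sections :
    (Proj (MvPolynomial.homogeneousSubmodule (Fin 3) k)).presheaf.map (homOfLE (inf_le_left : ((SmoothHypersurface.coordChartOpen (n := 1) k 0 : (Proj (MvPolynomial.homogeneousSubmodule (Fin 3) k)).Opens) ⊓ (SmoothHypersurface.coordChartOpen (n := 1) k 1 : (Proj (MvPolynomial.homogeneousSubmodule (Fin 3) k)).Opens)) ≤ (SmoothHypersurface.coordChartOpen (n := 1) k 0 : (Proj (MvPolynomial.homogeneousSubmodule (Fin 3) k)).Opens))).op ((Proj.awayToSection (MvPolynomial.homogeneousSubmodule (Fin 3) k) (X 0)).hom (toChart k 0 (X 0 + X 1 ^ 2))) =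
      ∑ _j : Fin 1, (Proj (MvPolynomial.homogeneousSubmodule (Fin 3) k)).presheaf.map (homOfLE (inf_coordChartOpen_le k)).op ((Proj.awayToSection (MvPolynomial.homogeneousSubmodule (Fin 3) k) (X 0 * X 1)).hom ((awayMap (MvPolynomial.homogeneousSubmodule (Fin 3) k) (X_mem 1) (rfl : (X 0 * X 1 : MvPolynomial (Fin 3) k) = X 0 * X 1)) (toChart k 0 (X 0)) ^ 2)) *
        (Proj (MvPolynomial.homogeneousSubmodule (Fin 3) k)).presheaf.map (homOfLE (inf_le_right : ((SmoothHypersurface.coordChartOpen (n := 1) k 0 : (Proj (MvPolynomial.homogeneousSubmodule (Fin 3) k)).Opens) ⊓ (SmoothHypersurface.coordChartOpen (n := 1) k 1 : (Proj (MvPolynomial.homogeneousSubmodule (Fin 3) k)).Opens)) ≤ (SmoothHypersurface.coordChartOpen (n := 1) k 1 : (Proj (MvPolynomial.homogeneousSubmodule (Fin 3) k)).Opens))).op ((Proj.awayToSection (MvPolynomial.homogeneousSubmodule (Fin 3) k) (X 1)).hom (toChart k 1 (X 0 + X 1 ^ 2))) := by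
  -- the two charts read in the overlap ring `(k[X]_{(X₀X₁)})₀`, and the relations of Part A
  let ι₀ : MvPolynomial (Fin 2) k →+* HomogeneousLocalization.Away (MvPolynomial.homogeneousSubmodule (Fin 3) k) (X 0 * X 1 : MvPolynomial (Fin 3) k) :=
    (awayMap (MvPolynomial.homogeneousSubmodule (Fin 3) k) (X_mem 1) (rfl : (X 0 * X 1 : MvPolynomial (Fin 3) k) = X 0 * X 1)).comp (toChart k 0).toRingHom
  let ι₁ : MvPolynomial (Fin 2) k →+* HomogeneousLocalization.Away (MvPolynomial.homogeneousSubmodule (Fin 3) k) (X 0 * X 1 : MvPolynomial (Fin 3) k) :=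
    (awayMap (MvPolynomial.homogeneousSubmodule (Fin 3) k) (X_mem 0) (mul_comm (X 0 : MvPolynomial (Fin 3) k) (X 1))).comp (toChart k 1).toRingHom
  have hι₀ : ∀ p, ι₀ p = (awayMap (MvPolynomial.homogeneousSubmodule (Fin 3) k) (X_mem 1) (rfl : (X 0 * X 1 : MvPolynomial (Fin 3) k) = X 0 * X 1)) (toChart k 0 p) := fun p => rfl
  have hι₁ : ∀ p, ι₁ p = (awayMap (MvPolynomial.homogeneousSubmodule (Fin 3) k) (X_mem 0) (mul_comm (X 0 : MvPolynomial (Fin 3) k) (X 1))) (toChart k 1 p) := fun p => rfl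
  have h3 : ι₁ (X 1) = ι₀ (X 1) * ι₁ (X 0) := by
    rw [hι₁, hι₁, hι₀, awayMap₁_toChart_X_one, awayMap₁_toChart_X_zero]
  have hti : ι₀ (X 0) * ι₁ (X 0) = 1 := by
    rw [hι₀, hι₁, awayMap₀_toChart_X_zero, awayMap₁_toChart_X_zero]; exact t_mul_ti k
  -- `Ψ : (k[X]_{(X₀X₁)})₀ → Γ(D₊(X₀) ∩ D₊(X₁))`
  let Ψ : HomogeneousLocalization.Away (MvPolynomial.homogeneousSubmodule (Fin 3) k) (X 0 * X 1 : MvPolynomial (Fin 3) k) →+* Γ((Proj (MvPolynomial.homogeneousSubmodule (Fin 3) k)), ((SmoothHypersurface.coordChartOpen (n := 1) k 0 : (Proj (MvPolynomial.homogeneousSubmodule (Fin 3) k)).Opens) ⊓ (SmoothHypersurface.coordChartOpen (n := 1) k 1 : (Proj (MvPolynomial.homogeneousSubmodule (Fin 3) k)).Opens))) :=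
    ((Proj (MvPolynomial.homogeneousSubmodule (Fin 3) k)).presheaf.map (homOfLE (inf_coordChartOpen_le k)).op).hom.comp (Proj.awayToSection (MvPolynomial.homogeneousSubmodule (Fin 3) k) (X 0 * X 1)).hom
  have hΨ : ∀ z, Ψ z = (Proj (MvPolynomial.homogeneousSubmodule (Fin 3) k)).presheaf.map (homOfLE (inf_coordChartOpen_le k)).op ((Proj.awayToSection (MvPolynomial.homogeneousSubmodule (Fin 3) k) (X 0 * X 1)).hom z) := fun z => rfl
  rw [Fin.sum_univ_one, res₀_awayToSection, res₁_awayToSection, ← hΨ, ← hΨ, ← hΨ, ← hι₀, ← hι₀, ← hι₁, ← map_mul,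
    conic_transition ι₀ ι₁ _ _ rfl rfl h3 hti]

/-- **The twisted splitting on sections**: every `c ∈ Γ(D₊(X₀) ∩ D₊(X₁))` is `a| + M·b|` modulo the ideal of the conic, `a ∈ Γ(D₊(X₀))`, `b ∈ Γ(D₊(X₁))`
(`twisted_splitting` transported along `(k[X]_{(X₀X₁)})₀ → Γ(D₊(X₀X₁)) → Γ(D₊(X₀) ∩ D₊(X₁))`). -/
theorem conic_twisted_splitting_sections (h01 : IsAffineOpen ((SmoothHypersurface.coordChartOpen (n := 1) k 0 : (Proj (MvPolynomial.homogeneousSubmodule (Fin 3) k)).Opens) ⊓ (SmoothHypersurface.coordChartOpen (n := 1) k 1 : (Proj (MvPolynomial.homogeneousSubmodule (Fin 3) k)).Opens))) (c : Fin 1 → Γ((Proj (MvPolynomial.homogeneousSubmodule (Fin 3) k)), ((SmoothHypersurface.coordChartOpen (n := 1) k 0 : (Proj (MvPolynomial.homogeneousSubmodule (Fin 3) k)).Opens) ⊓ (SmoothHypersurface.coordChartOpen (n := 1) k 1 : (Proj (MvPolynomial.homogeneousSubmodule (Fin 3) k)).Opens)))) :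
    ∃ (a : Fin 1 → Γ((Proj (MvPolynomial.homogeneousSubmodule (Fin 3) k)), (SmoothHypersurface.coordChartOpen (n := 1) k 0 : (Proj (MvPolynomial.homogeneousSubmodule (Fin 3) k)).Opens))) (b : Fin 1 → Γ((Proj (MvPolynomial.homogeneousSubmodule (Fin 3) k)), (SmoothHypersurface.coordChartOpen (n := 1) k 1 : (Proj (MvPolynomial.homogeneousSubmodule (Fin 3) k)).Opens))), ∀ κ,
      c κ - ((Proj (MvPolynomial.homogeneousSubmodule (Fin 3) k)).presheaf.map (homOfLE (inf_le_left : ((SmoothHypersurface.coordChartOpen (n := 1) k 0 : (Proj (MvPolynomial.homogeneousSubmodule (Fin 3) k)).Opens) ⊓ (SmoothHypersurface.coordChartOpen (n := 1) k 1 : (Proj (MvPolynomial.homogeneousSubmodule (Fin 3) k)).Opens)) ≤ (SmoothHypersurface.coordChartOpen (n := 1) k 0 : (Proj (MvPolynomial.homogeneousSubmodule (Fin 3) k)).Opens))).op (a κ) + ∑ j, (Proj (MvPolynomial.homogeneousSubmodule (Fin 3) k)).presheaf.map (homOfLE (inf_coordChartOpen_le k)).op ((Proj.awayToSection (MvPolynomial.homogeneousSubmodule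 (Fin 3) k) (X 0 * X 1)).hom ((awayMap (MvPolynomial.homogeneousSubmodule (Fin 3) k) (X_mem 1) (rfl : (X 0 * X 1 : MvPolynomial (Fin 3) k) = X 0 * X 1)) (toChart k 0 (X 0)) ^ 2)) * (Proj (MvPolynomial.homogeneousSubmodule (Fin 3) k)).presheaf.map (homOfLE (inf_le_right : ((SmoothHypersurface.coordChartOpen (n := 1) k 0 : (Proj (MvPolynomial.homogeneousSubmodule (Fin 3) k)).Opens) ⊓ (SmoothHypersurface.coordChartOpen (n := 1) k 1 : (Proj (MvPolynomial.homogeneousSubmodule (Fin 3) k)).Opens)) ≤ (SmoothHypersurface.coordChartOpen (n := 1) k 1 : (Proj (MvPolynomial.homogeneousSubmodule (Fin 3) k)).Opens))).op (b j)) ∈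
        (SmoothHypersurface.idealSheaf (X 0 * X 1 + X 2 ^ 2 : MvPolynomial (Fin 3) k)).ideal ⟨_, h01⟩ := by
  -- the two charts read in the overlap ring `(k[X]_{(X₀X₁)})₀`, and the relations of Part A
  let ι₀ : MvPolynomial (Fin 2) k →+* HomogeneousLocalization.Away (MvPolynomial.homogeneousSubmodule (Fin 3) k) (X 0 * X 1 : MvPolynomial (Fin 3) k) :=
    (awayMap (MvPolynomial.homogeneousSubmodule (Fin 3) k) (X_mem 1) (rfl : (X 0 * X 1 : MvPolynomial (Fin 3) k) = X 0 * X 1)).comp (toChart k 0).toRingHom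
  let ι₁ : MvPolynomial (Fin 2) k →+* HomogeneousLocalization.Away (MvPolynomial.homogeneousSubmodule (Fin 3) k) (X 0 * X 1 : MvPolynomial (Fin 3) k) :=
    (awayMap (MvPolynomial.homogeneousSubmodule (Fin 3) k) (X_mem 0) (mul_comm (X 0 : MvPolynomial (Fin 3) k) (X 1))).comp (toChart k 1).toRingHom
  have hι₀ : ∀ p, ι₀ p = (awayMap (MvPolynomial.homogeneousSubmodule (Fin 3) k) (X_mem 1) (rfl : (X 0 * X 1 : MvPolynomial (Fin 3) k) = X 0 * X 1)) (toChart k 0 p) := fun p => rfl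
  have hι₁ : ∀ p, ι₁ p = (awayMap (MvPolynomial.homogeneousSubmodule (Fin 3) k) (X_mem 0) (mul_comm (X 0 : MvPolynomial (Fin 3) k) (X 1))) (toChart k 1 p) := fun p => rfl
  have h3 : ι₁ (X 1) = ι₀ (X 1) * ι₁ (X 0) := by
    rw [hι₁, hι₁, hι₀, awayMap₁_toChart_X_one, awayMap₁_toChart_X_zero]
  have hti : ι₀ (X 0) * ι₁ (X 0) = 1 := by
    rw [hι₀, hι₁, awayMap₀_toChart_X_zero, awayMap₁_toChart_X_zero]; exact t_mul_ti k
  -- `Ψ : (k[X]_{(X₀X₁)})₀ → Γ(D₊(X₀) ∩ D₊(X₁))`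
  let Ψ : HomogeneousLocalization.Away (MvPolynomial.homogeneousSubmodule (Fin 3) k) (X 0 * X 1 : MvPolynomial (Fin 3) k) →+* Γ((Proj (MvPolynomial.homogeneousSubmodule (Fin 3) k)), ((SmoothHypersurface.coordChartOpen (n := 1) k 0 : (Proj (MvPolynomial.homogeneousSubmodule (Fin 3) k)).Opens) ⊓ (SmoothHypersurface.coordChartOpen (n := 1) k 1 : (Proj (MvPolynomial.homogeneousSubmodule (Fin 3) k)).Opens))) :=
    ((Proj (MvPolynomial.homogeneousSubmodule (Fin 3) k)).presheaf.map (homOfLE (inf_coordChartOpen_le k)).op).hom.comp (Proj.awayToSection (MvPolynomial.homogeneousSubmodule (Fin 3) k) (X 0 * X 1)).hom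
  have hΨ : ∀ z, Ψ z = (Proj (MvPolynomial.homogeneousSubmodule (Fin 3) k)).presheaf.map (homOfLE (inf_coordChartOpen_le k)).op ((Proj.awayToSection (MvPolynomial.homogeneousSubmodule (Fin 3) k) (X 0 * X 1)).hom z) := fun z => rfl
  have hC : ∀ c : k, ι₁ (C c) = ι₀ (C c) := fun c => by rw [hι₀, hι₁]; exact awayMap_toChart_C k c
  have hgen : ∀ γ, ∃ (N : ℕ) (p : MvPolynomial (Fin 2) k), γ = ι₀ p * ι₁ (X 0) ^ N := by
    intro γ
    obtain ⟨N, p, h⟩ := exists_eq_awayMap₀_mul_pow k γ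
    exact ⟨N, p, by rw [hι₀, hι₁, awayMap₁_toChart_X_zero]; exact h⟩
  obtain ⟨γ, hγ⟩ := surjective_res_awayToSection₀₁ k (c 0)
  have hγ' : Ψ γ = c 0 := hγ
  obtain ⟨α, β, hαβ⟩ := twisted_splitting ι₀ ι₁ _ _ rfl rfl h3 hti hC hgen γ
  refine ⟨fun _ => (Proj.awayToSection (MvPolynomial.homogeneousSubmodule (Fin 3) k) (X 0)).hom (toChart k 0 α), fun _ => (Proj.awayToSection (MvPolynomial.homogeneousSubmodule (Fin 3) k) (X 1)).hom (toChart k 1 β), fun κ => ?_⟩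
  obtain rfl : κ = 0 := Subsingleton.elim _ _
  have hmem := Ideal.mem_map_of_mem Ψ hαβ
  rw [Ideal.map_span, Set.image_singleton] at hmem
  have hle : Ideal.span {Ψ (ι₀ (X 0 + X 1 ^ 2))} ≤
      (SmoothHypersurface.idealSheaf (X 0 * X 1 + X 2 ^ 2 : MvPolynomial (Fin 3) k)).ideal ⟨_, h01⟩ := by
    refine (Ideal.span_singleton_le_iff_mem _).2 ?_
    rw [hι₀, hΨ, ← res₀_awayToSection]
    exact res₀_toChart_conic_mem k h01
  -- align the goal with `Ψ (γ - (ι₀ α + ι₀(y₀)² ι₁ β))` by explicit (syntactic) rewrites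
  have e_a : (Proj (MvPolynomial.homogeneousSubmodule (Fin 3) k)).presheaf.map (homOfLE (inf_le_left : ((SmoothHypersurface.coordChartOpen (n := 1) k 0 : (Proj (MvPolynomial.homogeneousSubmodule (Fin 3) k)).Opens) ⊓ (SmoothHypersurface.coordChartOpen (n := 1) k 1 : (Proj (MvPolynomial.homogeneousSubmodule (Fin 3) k)).Opens)) ≤ (SmoothHypersurface.coordChartOpen (n := 1) k 0 : (Proj (MvPolynomial.homogeneousSubmodule (Fin 3) k)).Opens))).op ((Proj.awayToSection (MvPolynomial.homogeneousSubmodule (Fin 3) k) (X 0)).hom (toChart k 0 α)) = Ψ (ι₀ α) := res₀_awayToSection k _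
  have e_b : (Proj (MvPolynomial.homogeneousSubmodule (Fin 3) k)).presheaf.map (homOfLE (inf_le_right : ((SmoothHypersurface.coordChartOpen (n := 1) k 0 : (Proj (MvPolynomial.homogeneousSubmodule (Fin 3) k)).Opens) ⊓ (SmoothHypersurface.coordChartOpen (n := 1) k 1 : (Proj (MvPolynomial.homogeneousSubmodule (Fin 3) k)).Opens)) ≤ (SmoothHypersurface.coordChartOpen (n := 1) k 1 : (Proj (MvPolynomial.homogeneousSubmodule (Fin 3) k)).Opens))).op ((Proj.awayToSection (MvPolynomial.homogeneousSubmodule (Fin 3) k) (X 1)).hom (toChart k 1 β)) = Ψ (ι₁ β) := res₁_awayToSection k _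
  have e_M : (Proj (MvPolynomial.homogeneousSubmodule (Fin 3) k)).presheaf.map (homOfLE (inf_coordChartOpen_le k)).op ((Proj.awayToSection (MvPolynomial.homogeneousSubmodule (Fin 3) k) (X 0 * X 1)).hom ((awayMap (MvPolynomial.homogeneousSubmodule (Fin 3) k) (X_mem 1) (rfl : (X 0 * X 1 : MvPolynomial (Fin 3) k) = X 0 * X 1)) (toChart k 0 (X 0)) ^ 2)) = Ψ (ι₀ (X 0) ^ 2) := rfl
  have eG : c 0 - ((Proj (MvPolynomial.homogeneousSubmodule (Fin 3) k)).presheaf.map (homOfLE (inf_le_left : ((SmoothHypersurface.coordChartOpen (n := 1) k 0 : (Proj (MvPolynomial.homogeneousSubmodule (Fin 3) k)).Opens) ⊓ (SmoothHypersurface.coordChartOpen (n := 1) k 1 : (Proj (MvPolynomial.homogeneousSubmodule (Fin 3) k)).Opens)) ≤ (SmoothHypersurface.coordChartOpen (n := 1) k 0 : (Proj (MvPolynomial.homogeneousSubmodule (Fin 3) k)).Opens))).op ((Proj.awayToSection (MvPolynomial.homogeneousSubmodule (Fin 3) k) (X 0)).hom (toChart k 0 α)) +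
        ∑ _j : Fin 1, (Proj (MvPolynomial.homogeneousSubmodule (Fin 3) k)).presheaf.map (homOfLE (inf_coordChartOpen_le k)).op ((Proj.awayToSection (MvPolynomial.homogeneousSubmodule (Fin 3) k) (X 0 * X 1)).hom ((awayMap (MvPolynomial.homogeneousSubmodule (Fin 3) k) (X_mem 1) (rfl : (X 0 * X 1 : MvPolynomial (Fin 3) k) = X 0 * X 1)) (toChart k 0 (X 0)) ^ 2)) * (Proj (MvPolynomial.homogeneousSubmodule (Fin 3) k)).presheaf.map (homOfLE (inf_le_right : ((SmoothHypersurface.coordChartOpen (n := 1) k 0 : (Proj (MvPolynomial.homogeneousSubmodule (Fin 3) k)).Opens) ⊓ (SmoothHypersurface.coordChartOpen (n := 1) k 1 : (Proj (MvPolynomial.homogeneousSubmodule (Fin 3) k)).Opens)) ≤ (SmoothHypersurface.coordChartOpen (n := 1) k 1 : (Proj (MvPolynomial.homogeneousSubmodule (Fin 3) k)).Opens))).op ((Proj.awayToSection (MvPolynomial.homogeneousSubmodule (Fin 3) k) (X 1)).hom (toChart k 1 β))) =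
      Ψ (γ - (ι₀ α + ι₀ (X 0) ^ 2 * ι₁ β)) := by
    rw [Fin.sum_univ_one, e_a, e_b, e_M, ← hγ', map_sub, map_add, map_mul]
  rw [eG]
  exact hle hmem

/-- ★★ **THE ℙ² CONIC MODEL CERTIFICATE of `DirStepUnobs`** — `DirStepUnobs ℙ²_k univ _ V₊(X₀X₁ + X₂²) _` for every field `k`: the embedded
deformations of a smooth conic in the plane are unobstructed (`H¹(C, 𝒩_{C/ℙ²}) = H¹(ℙ¹, 𝒪(4)) = 0`), in the tree's Čech vocabulary, as the FIRST
CUSTOMER of res-L1-w45b-nose-w1's producer `dirStepUnobs_univ_of_two_charts` (✓ p655133): charts `D₊(X₀)`, `D₊(X₁)`, generators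
`toChart(y₀ + y₁²) = F/X₀², F/X₁²`, transition `M = (X₁/X₀)²`, twisted splitting `twisted_splitting`.  Dictionary to res-L1-w45b-lead-1's S10
customer: `Γ_q = {x₁² + y₁z₁ = 0} ⊂ E_q ≅ ℙ²` is `V₊(X₀X₁ + X₂²)` under `(X₀, X₁, X₂) = (y₁, z₁, x₁)`, the charts being `Eq.y = D₊(X₀)`, `Eq.z = D₊(X₁)`;
the NEST clause `DirStepUnobs G' E' _ Γ_q _` then follows by res-L1-w45b-iso-w2's model door (H2) `dirStepUnobs_of_model_iso` from ONE isomorphism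
«fresh plane ≅ ℙ²» carrying `Γ_q` onto the conic. [OURS · L1 W4.5b · EL♮(3) · WIDTH TABLE D3 brick D3-8; NOT a statement of the manuscript; counted 0] -/
theorem dirStepUnobs_conic :
    DirStepUnobs (Proj (MvPolynomial.homogeneousSubmodule (Fin 3) k)) Set.univ isClosed_univ
      (SmoothHypersurface.zeroLocusClosed (X 0 * X 1 + X 2 ^ 2 : MvPolynomial (Fin 3) k) : Set _)
      (SmoothHypersurface.zeroLocusClosed (X 0 * X 1 + X 2 ^ 2 : MvPolynomial (Fin 3) k)).isClosed := by
  -- `ℙ²_k` is integral (hence reduced) and locally Noetherian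
  haveI : IsIntegral (Proj (MvPolynomial.homogeneousSubmodule (Fin 3) k)) := Literature.AlgebraicGeometry.Resolution.isIntegral_projectiveSpace 2 k
  haveI : IsLocallyNoetherian (Proj (MvPolynomial.homogeneousSubmodule (Fin 3) k)) := LocallyOfFiniteType.isLocallyNoetherian (projectiveSpace 2 k).hom
  -- the overlap `D₊(X₀) ∩ D₊(X₁) = D₊(X₀X₁)` is affine
  have h01 : IsAffineOpen ((SmoothHypersurface.coordChartOpen (n := 1) k 0 : (Proj (MvPolynomial.homogeneousSubmodule (Fin 3) k)).Opens) ⊓ (SmoothHypersurface.coordChartOpen (n := 1) k 1 : (Proj (MvPolynomial.homogeneousSubmodule (Fin 3) k)).Opens)) := by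
    rw [le_antisymm (inf_coordChartOpen_le k) (basicOpen_mul_le_inf_coordChartOpen k)]
    exact Proj.isAffineOpen_basicOpen _ _ (X01_mem k) two_pos
  refine dirStepUnobs_univ_of_two_charts (Proj (MvPolynomial.homogeneousSubmodule (Fin 3) k)) _ _
    (SmoothHypersurface.coordChartOpen (n := 1) k 0) (SmoothHypersurface.coordChartOpen (n := 1) k 1) h01
    (fun p hp => zeroLocus_conic_subset k p hp)
    (fun _ : Fin 1 => (Proj.awayToSection (MvPolynomial.homogeneousSubmodule (Fin 3) k) (X 0)).hom (toChart k 0 (X 0 + X 1 ^ 2)))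
    (fun _ : Fin 1 => (Proj.awayToSection (MvPolynomial.homogeneousSubmodule (Fin 3) k) (X 1)).hom (toChart k 1 (X 0 + X 1 ^ 2)))
    (isQuasiRegular_toChart_conic k 0) (isQuasiRegular_toChart_conic k 1) ?_ ?_
    (fun _ _ => (Proj (MvPolynomial.homogeneousSubmodule (Fin 3) k)).presheaf.map (homOfLE (inf_coordChartOpen_le k)).op ((Proj.awayToSection (MvPolynomial.homogeneousSubmodule (Fin 3) k) (X 0 * X 1)).hom ((awayMap (MvPolynomial.homogeneousSubmodule (Fin 3) k) (X_mem 1) (rfl : (X 0 * X 1 : MvPolynomial (Fin 3) k) = X 0 * X 1)) (toChart k 0 (X 0)) ^ 2)))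
    (fun _ => conic_transition_sections k) (conic_twisted_splitting_sections k h01)
  · rw [Set.range_const]; exact span_toChart_conic_eq_ideal k 0 (Or.inl rfl)
  · rw [Set.range_const]; exact span_toChart_conic_eq_ideal k 1 (Or.inr rfl)

end Certificate

end S10Conic

end Summit.ResolutionOfSingularities.ResolutionOfSingularities.Cruxes.EquisingularLiftNat.Sections

end
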